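import Literature.NumberTheory.LFunctions.XiHigherDerivativesCriticalZeros
import Literature.NumberTheory.LFunctions.XiLaguerreSeparationRH
import HarnessLib

/-!
# `N₀^{(m+1)}(T) ≥ N₀^{(m)}(T) − 1`: Rolle on the critical line WITH multiplicity, for every `m` and `T`

RH-FREE (every statement below is an unconditional theorem of this tree; nothing here bears on the
truth of RH). Topic `Literature/NumberTheory/LFunctions`, namespace `Literature.NumberTheory.LFunctions`
(helpers in `XiDerivCritStep`). Sharpens the `m`-fold Rolle transfer of
`XiHigherDerivativesCriticalZeros.lean` (there: DISTINCT critical zeros, `#crit(ξ^{(m)}) ≤ #crit(ξ^{(m+1)}) + 1`,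
whence `N₀ˢ(T) ≤ N₀^{(m)}(T) + m`) to the counts WITH MULTIPLICITY `N₀^{(m)}(T) = xiDerivCriticalZeroCount m T`
(Conrey 1983 §1: "`N_m(T)` the number of zeros of `ξ^{(m)}(½ + it)`, `0 < t ≤ T`"):

* at a zero `s` of `ξ^{(m)}` the multiplicity drops by exactly one under differentiation
  (`XiDerivCritStep.order_succ_add_one`, Mathlib `AnalyticAt.analyticOrderAt_deriv_add_one`), so the OLD
  critical zeros of `ξ^{(m+1)}` (those which are zeros of `ξ^{(m)}`) carry total multiplicity
  `N₀^{(m)}(T) − #crit(ξ^{(m)}, T)` (`XiDerivCritStep.sum_old_add_card`);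
* between consecutive critical zeros of `ξ^{(m)}` Rolle gives a NEW critical zero of `ξ^{(m+1)}` (not a
  zero of `ξ^{(m)}`), and these are distinct: `#new ≥ #crit(ξ^{(m)}, T) − 1`
  (`XiDerivCritStep.card_le_card_new_add_one`);
* hence **`N₀^{(m)}(T) ≤ N₀^{(m+1)}(T) + 1`** for all `m`, `T`
  (`xiDerivCriticalZeroCount_le_succ_add_one`), **`N₀^{(0)}(T) ≤ N₀^{(m)}(T) + m`**
  (`xiDerivCriticalZeroCount_zero_le_add`), and — under RH, where `N₀^{(m)} = N^{(m)}`
  (`xiDerivCriticalZeroCount_eq_of_RH`) — **RH ⇒ `N^{(m)}(T) ≤ N^{(m+1)}(T) + 1`** and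
  `N^{(0)}(T) ≤ N^{(m)}(T) + m` for ALL `T` (`riemannHypothesis_imp_xiDerivZeroCount_le_succ_add_one`), an
  exact one-sided form of Conrey's Lemma 2 (`N^{(m)}(T) = N(T) + O_m(log T)` unconditionally);
* and the other side UNDER RH: the new zeros of `ξ^{(m+1)}` are simple and separated by the zeros of
  `ξ^{(m)}` (Laguerre's theorem, `XiLaguerreSeparationRH.lean`), so `#new ≤ #crit(ξ^{(m)}, T) + 1`
  (`XiDerivCritStep.card_new_le_card_add_one`) and **RH ⇒ `|N^{(m+1)}(T) − N^{(m)}(T)| ≤ 1`,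
  `|N^{(m)}(T) − N^{(0)}(T)| ≤ m` for all `T`** (`riemannHypothesis_imp_abs_xiDerivZeroCount_succ_sub_le_one`).

[cite: Conrey1983, §1 (p. 49) and Lemma 2 (p. 52)]. AI-produced formalisation
(literature-prover-rh-lit-frontier-1-g12-0, 2026-08-27); AI review is weaker than expert review.
-/

noncomputable section

open Complex Filter Set
open scoped Real Topology

namespace Literature.NumberTheory.LFunctions

open XiDerivCritical

namespace XiDerivCritStep

/-- **The multiplicity drops by one under differentiation**: at a zero `s` of `ξ^{(m)}`,
`mult(ξ^{(m+1)}, s) + 1 = mult(ξ^{(m)}, s)`. [cite: Conrey1983, §1 (p. 49)] -/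
theorem order_succ_add_one (m : ℕ) {s : ℂ} (hs : iteratedDeriv m riemannXi s = 0) :
    (analyticOrderAt (iteratedDeriv (m + 1) riemannXi) s).toNat + 1 =
      (analyticOrderAt (iteratedDeriv m riemannXi) s).toNat := by
  have ha : AnalyticAt ℂ (iteratedDeriv m riemannXi) s := analyticOnNhd_iteratedDeriv_riemannXi m s trivial
  have h := ha.analyticOrderAt_deriv_add_one
  have hfun : (fun z ↦ iteratedDeriv m riemannXi z - iteratedDeriv m riemannXi s) =
      iteratedDeriv m riemannXi := by
    funext z; rw [hs, sub_zero]
  rw [hfun, ← iteratedDeriv_succ] at h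
  obtain ⟨a, ha'⟩ := ENat.ne_top_iff_exists.mp (analyticOrderAt_ne_top (m + 1) s)
  obtain ⟨b, hb⟩ := ENat.ne_top_iff_exists.mp (analyticOrderAt_ne_top m s)
  rw [← ha', ← hb] at h ⊢
  simp only [ENat.toNat_coe]
  have : ((a + 1 : ℕ) : ℕ∞) = (b : ℕ∞) := by push_cast; exact h
  exact_mod_cast this

/-- **Old critical zeros**: summing `mult(ξ^{(m+1)}, s)` over the critical zeros `s` of `ξ^{(m)}` in the box
and adding their number gives `N₀^{(m)}(T)`. [cite: Conrey1983, §1 (p. 49)] -/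
theorem sum_old_add_card (m : ℕ) (T : ℝ) :
    ∑ s ∈ (criticalBox_finite m T).toFinset, (analyticOrderAt (iteratedDeriv (m + 1) riemannXi) s).toNat +
        (criticalBox_finite m T).toFinset.card = xiDerivCriticalZeroCount m T := by
  classical
  unfold xiDerivCriticalZeroCount
  rw [finsum_mem_eq_finite_toFinset_sum _ (criticalBox_finite m T), Finset.card_eq_sum_ones,
    ← Finset.sum_add_distrib]
  refine Finset.sum_congr rfl fun s hs ↦ ?_
  rw [Set.Finite.mem_toFinset] at hs
  exact order_succ_add_one m hs.1.1

/-- The old zeros carry the same total multiplicity when summed over the critical box of `ξ^{(m+1)}`: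
`Σ_{s ∈ crit(ξ^{(m+1)}), ξ^{(m)}(s) = 0} mult(ξ^{(m+1)}, s) = Σ_{s ∈ crit(ξ^{(m)})} mult(ξ^{(m+1)}, s)`.
[cite: Conrey1983, §1 (p. 49)] -/
theorem sum_old_eq (m : ℕ) (T : ℝ) :
    ∑ s ∈ ((criticalBox_finite (m + 1) T).toFinset.filter fun s ↦ iteratedDeriv m riemannXi s = 0),
        (analyticOrderAt (iteratedDeriv (m + 1) riemannXi) s).toNat =
      ∑ s ∈ (criticalBox_finite m T).toFinset,
        (analyticOrderAt (iteratedDeriv (m + 1) riemannXi) s).toNat := by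
  classical
  refine Finset.sum_subset ?_ ?_
  · -- Old ⊆ crit(ξ^{(m)})
    intro s hs
    rw [Finset.mem_filter, Set.Finite.mem_toFinset] at hs
    rw [Set.Finite.mem_toFinset]
    exact ⟨⟨hs.2, hs.1.1.2.1, hs.1.1.2.2⟩, hs.1.2⟩
  · -- on crit(ξ^{(m)}) ∖ Old the multiplicity of ξ^{(m+1)} vanishes
    intro s hs hns
    rw [Set.Finite.mem_toFinset] at hs
    have hne : iteratedDeriv (m + 1) riemannXi s ≠ 0 := by
      intro h0
      apply hns
      rw [Finset.mem_filter, Set.Finite.mem_toFinset]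
      exact ⟨⟨⟨h0, hs.1.2.1, hs.1.2.2⟩, hs.2⟩, hs.1.1⟩
    have h0 : analyticOrderAt (iteratedDeriv (m + 1) riemannXi) s = 0 := by
      rw [(analyticOnNhd_iteratedDeriv_riemannXi (m + 1) s trivial).analyticOrderAt_eq_zero]
      exact hne
    rw [h0]; rfl

/-- **Rolle, new zeros**: the NEW critical zeros of `ξ^{(m+1)}` with ordinates in `(0, T]` (critical zeros
which are not zeros of `ξ^{(m)}`) number at least `#crit(ξ^{(m)}, T) − 1`: between consecutive critical zeros
of `ξ^{(m)}` lies a critical zero of `ξ^{(m+1)}`, which is not a zero of `ξ^{(m)}`.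
[cite: Conrey1983, §1 (p. 49)] -/
theorem card_le_card_new_add_one (m : ℕ) (T : ℝ) :
    (criticalBox_finite m T).toFinset.card ≤
      ((criticalBox_finite (m + 1) T).toFinset.filter fun s ↦ iteratedDeriv m riemannXi s ≠ 0).card + 1 := by
  classical
  set C : Set ℂ := {s ∈ xiDerivZeroBox m T | s.re = 1 / 2} with hC
  have hCfin : C.Finite := criticalBox_finite m T
  have hinjOn : InjOn Complex.im C := by
    intro ρ hρ ρ' hρ' h
    exact Complex.ext (by rw [hρ.2, hρ'.2]) h
  set tF : Finset ℝ := hCfin.toFinset.image Complex.im with htF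
  set k : ℕ := tF.card with hk
  have hcardC : hCfin.toFinset.card = k := by
    rw [hk, htF, Finset.card_image_of_injOn (by
      intro ρ hρ ρ' hρ' h
      exact hinjOn ((Set.Finite.mem_toFinset hCfin).1 hρ)
        ((Set.Finite.mem_toFinset hCfin).1 hρ') h)]
  rw [hcardC]
  have hmem : ∀ u ∈ tF, iteratedDeriv m riemannXi (1 / 2 + (u : ℂ) * I) = 0 ∧ 0 < u ∧ u ≤ T := by
    intro u hu
    rw [htF, Finset.mem_image] at hu
    obtain ⟨ρ, hρ, rfl⟩ := hu
    rw [Set.Finite.mem_toFinset] at hρ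
    have hρeq : (1 / 2 : ℂ) + (ρ.im : ℂ) * I = ρ := by
      apply Complex.ext <;> simp [hρ.2]
    rw [hρeq]
    exact ⟨hρ.1.1, hρ.1.2.1, hρ.1.2.2⟩
  -- conversely every critical zero ordinate in `(0, T]` is in `tF`
  have hmem' : ∀ u : ℝ, iteratedDeriv m riemannXi (1 / 2 + (u : ℂ) * I) = 0 → 0 < u → u ≤ T → u ∈ tF := by
    intro u hu h0 hT
    rw [htF, Finset.mem_image]
    refine ⟨1 / 2 + (u : ℂ) * I, ?_, by simp⟩
    rw [Set.Finite.mem_toFinset]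
    exact ⟨⟨hu, by simpa using h0, by simpa using hT⟩, by simp⟩
  set t : Fin k ↪o ℝ := tF.orderEmbOfFin hk.symm with ht
  have htmem : ∀ j : Fin k, t j ∈ tF := fun j ↦ by
    rw [ht]
    exact Finset.orderEmbOfFin_mem tF hk.symm j
  have htsurj : ∀ u ∈ tF, ∃ j : Fin k, t j = u := by
    intro u hu
    have : u ∈ Set.range t := by rw [ht, Finset.range_orderEmbOfFin]; exact hu
    exact this
  have htmono : StrictMono t := t.strictMono
  rcases Nat.lt_or_ge k 2 with hk2 | hk2
  · omega
  have hrolle : ∀ j : Fin (k - 1), ∃ c : ℝ,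
      t ⟨j.1, by omega⟩ < c ∧ c < t ⟨j.1 + 1, by omega⟩ ∧
        iteratedDeriv (m + 1) riemannXi (1 / 2 + (c : ℂ) * I) = 0 := by
    intro j
    have hlt : t ⟨j.1, by omega⟩ < t ⟨j.1 + 1, by omega⟩ :=
      htmono (Fin.mk_lt_mk.2 (Nat.lt_succ_self _))
    obtain ⟨c, hc, hc0⟩ := exists_iteratedDeriv_succ_critical_zero_between m hlt
      (hmem _ (htmem _)).1 (hmem _ (htmem _)).1
    exact ⟨c, hc.1, hc.2, hc0⟩
  choose c hc_lo hc_hi hc_zero using hrolle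
  have hcmono : StrictMono c := by
    intro i j hij
    have hij' : i.1 < j.1 := hij
    calc c i < t ⟨i.1 + 1, by omega⟩ := hc_hi i
      _ ≤ t ⟨j.1, by omega⟩ := htmono.monotone (Fin.mk_le_mk.2 (by omega))
      _ < c j := hc_lo j
  have hcpos : ∀ j, 0 < c j := fun j ↦ by
    have h0 : 0 < t ⟨j.1, by omega⟩ := (hmem _ (htmem _)).2.1
    linarith [hc_lo j]
  have hcle : ∀ j, c j ≤ T := fun j ↦ by
    have h1 : t ⟨j.1 + 1, by omega⟩ ≤ T := (hmem _ (htmem _)).2.2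
    linarith [hc_hi j]
  -- the Rolle points are NEW: not zeros of `ξ^{(m)}` (they lie strictly between consecutive ordinates)
  have hcnew : ∀ j, iteratedDeriv m riemannXi (1 / 2 + (c j : ℂ) * I) ≠ 0 := by
    intro j h0
    obtain ⟨i, hi⟩ := htsurj (c j) (hmem' (c j) h0 (hcpos j) (hcle j))
    have h1 : t ⟨j.1, by omega⟩ < t i := by rw [hi]; exact hc_lo j
    have h2 : t i < t ⟨j.1 + 1, by omega⟩ := by rw [hi]; exact hc_hi j
    have h1' := htmono.lt_iff_lt.1 h1
    have h2' := htmono.lt_iff_lt.1 h2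
    rw [Fin.lt_def] at h1' h2'
    simp only at h1' h2'
    omega
  set pt : Fin (k - 1) → ℂ := fun j ↦ (1 / 2 : ℂ) + (c j : ℂ) * I with hpt
  have hinj : Function.Injective pt := by
    intro i j hij
    have him := congrArg Complex.im hij
    simp only [hpt, add_im, mul_im, ofReal_re, I_im, mul_one, ofReal_im, I_re, mul_zero, add_zero]
      at him
    have h12 : ((1 / 2 : ℂ)).im = 0 := by norm_num
    rw [h12, zero_add, zero_add] at him
    exact hcmono.injective him
  set P : Finset ℂ := Finset.univ.image pt with hP
  have hPcard : P.card = k - 1 := by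
    rw [hP, Finset.card_image_of_injective _ hinj, Finset.card_univ, Fintype.card_fin]
  have hPsub : P ⊆ (criticalBox_finite (m + 1) T).toFinset.filter
      fun s ↦ iteratedDeriv m riemannXi s ≠ 0 := by
    intro s hs
    rw [hP, Finset.mem_image] at hs
    obtain ⟨j, -, rfl⟩ := hs
    rw [Finset.mem_filter, Set.Finite.mem_toFinset]
    refine ⟨⟨⟨hc_zero j, by simpa [hpt] using hcpos j, by simpa [hpt] using hcle j⟩, by simp [hpt]⟩,
      hcnew j⟩
  have := Finset.card_le_card hPsub
  omega

end XiDerivCritStep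

open XiDerivCritStep

/-- **`N₀^{(m)}(T) ≤ N₀^{(m+1)}(T) + 1` for every `m` and every `T`**: differentiating `ξ^{(m)}` loses at
most one zero on the critical line up to height `T`, counted WITH multiplicity (old zeros lose one unit
of multiplicity each; Rolle supplies a new zero in each of the `#crit − 1` gaps).
[cite: Conrey1983, §1 (p. 49)] -/
theorem xiDerivCriticalZeroCount_le_succ_add_one (m : ℕ) (T : ℝ) :
    xiDerivCriticalZeroCount m T ≤ xiDerivCriticalZeroCount (m + 1) T + 1 := by
  classical
  have h1 := sum_old_add_card m T
  have h2 := sum_old_eq m T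
  have h3 := card_le_card_new_add_one m T
  -- `N₀^{(m+1)} = Σ_old + Σ_new ≥ Σ_old + #new`
  have h4 : xiDerivCriticalZeroCount (m + 1) T =
      ∑ s ∈ ((criticalBox_finite (m + 1) T).toFinset.filter fun s ↦ iteratedDeriv m riemannXi s = 0),
          (analyticOrderAt (iteratedDeriv (m + 1) riemannXi) s).toNat +
        ∑ s ∈ ((criticalBox_finite (m + 1) T).toFinset.filter fun s ↦ ¬iteratedDeriv m riemannXi s = 0),
          (analyticOrderAt (iteratedDeriv (m + 1) riemannXi) s).toNat := by
    unfold xiDerivCriticalZeroCount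
    rw [finsum_mem_eq_finite_toFinset_sum _ (criticalBox_finite (m + 1) T)]
    exact (Finset.sum_filter_add_sum_filter_not _ _ _).symm
  have h5 : ((criticalBox_finite (m + 1) T).toFinset.filter fun s ↦ iteratedDeriv m riemannXi s ≠ 0).card ≤
      ∑ s ∈ ((criticalBox_finite (m + 1) T).toFinset.filter fun s ↦ ¬iteratedDeriv m riemannXi s = 0),
        (analyticOrderAt (iteratedDeriv (m + 1) riemannXi) s).toNat := by
    rw [Finset.card_eq_sum_ones]
    refine Finset.sum_le_sum fun s hs ↦ ?_
    rw [Finset.mem_filter, Set.Finite.mem_toFinset] at hs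
    exact one_le_analyticOrderAt_toNat (m + 1) hs.1.1.1
  omega

/-- Telescoped: **`N₀^{(m)}(T) ≤ N₀^{(m')}(T) + (m' − m)` for `m ≤ m'`**, in particular
`N₀^{(0)}(T) ≤ N₀^{(m)}(T) + m`. [cite: Conrey1983, §1 (p. 49)] -/
theorem xiDerivCriticalZeroCount_zero_le_add (m : ℕ) (T : ℝ) :
    xiDerivCriticalZeroCount 0 T ≤ xiDerivCriticalZeroCount m T + m := by
  induction m with
  | zero => simp
  | succ m ih =>
    have := xiDerivCriticalZeroCount_le_succ_add_one m T
    omega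

/-- **RH ⇒ `N^{(m)}(T) ≤ N^{(m+1)}(T) + 1` for ALL `T`** (under RH every zero of `ξ^{(m)}` is on the line,
`xiDerivCriticalZeroCount_eq_of_RH`): an exact one-sided form, under RH, of Conrey's Lemma 2
`N^{(m+1)}(T) = N^{(m)}(T) + O(log T)`. [cite: Conrey1983, §1 (p. 49) and Lemma 2 (p. 52)] -/
theorem riemannHypothesis_imp_xiDerivZeroCount_le_succ_add_one (hRH : RiemannHypothesis) (m : ℕ)
    (T : ℝ) : xiDerivZeroCount m T ≤ xiDerivZeroCount (m + 1) T + 1 := by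
  rw [← xiDerivCriticalZeroCount_eq_of_RH hRH m T, ← xiDerivCriticalZeroCount_eq_of_RH hRH (m + 1) T]
  exact xiDerivCriticalZeroCount_le_succ_add_one m T

/-- **RH ⇒ `N^{(0)}(T) ≤ N^{(m)}(T) + m` for all `T`.** [cite: Conrey1983, §1 (p. 49) and Lemma 2 (p. 52)] -/
theorem riemannHypothesis_imp_xiDerivZeroCount_zero_le_add (hRH : RiemannHypothesis) (m : ℕ) (T : ℝ) :
    xiDerivZeroCount 0 T ≤ xiDerivZeroCount m T + m := by
  rw [← xiDerivCriticalZeroCount_eq_of_RH hRH 0 T, ← xiDerivCriticalZeroCount_eq_of_RH hRH m T]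
  exact xiDerivCriticalZeroCount_zero_le_add m T

/-! ## Under RH: the new zeros are simple and separated, so `N^{(m+1)}(T) ≤ N^{(m)}(T) + 1` -/

namespace XiDerivCritStep

open Literature.Analysis.Complex

/-- **Laguerre uniqueness on a closed interval**: for `f` real entire of order `< 2` with only real zeros
(and at least one), `f′` cannot vanish at both ends of a real interval `[c, c']`, `c < c'`, free of zeros of
`f` (`f′/f` is strictly decreasing there). [cite: Boas1954, Theorem 2.8.1 (p. 23)] -/
theorem deriv_ne_zero_of_zero_free {f : ℂ → ℂ} (hf : Differentiable ℂ f) {ρ C : ℝ} (hρ0 : 0 ≤ ρ)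
    (hρ : ρ < 2) (hgr : ∀ z, ‖f z‖ ≤ C * Real.exp (‖z‖ ^ ρ)) (hreal : ∀ x : ℝ, (f x).im = 0)
    (hex : ∃ a, f a = 0) (hzeros : ∀ a, f a = 0 → a.im = 0) {c c' : ℝ} (hcc' : c < c')
    (hne : ∀ x ∈ Icc c c', f x ≠ 0) (hc : deriv f c = 0) : deriv f c' ≠ 0 := by
  intro hc'
  set φ : ℝ → ℝ := fun t ↦ (deriv f t / f t).re with hφ
  have hderiv : ∀ t ∈ Icc c c', HasDerivAt φ ((deriv (fun z ↦ deriv f z / f z) t).re) t := by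
    intro t ht
    have hga : AnalyticAt ℂ (fun z ↦ deriv f z / f z) t :=
      ((hf.analyticAt _).deriv).div (hf.analyticAt _) (hne t ht)
    exact hga.differentiableAt.hasDerivAt.real_of_complex
  have hanti : StrictAntiOn φ (Icc c c') := by
    refine strictAntiOn_of_deriv_neg (convex_Icc c c')
      (fun t ht ↦ (hderiv t ht).continuousAt.continuousWithinAt) ?_
    intro t ht
    rw [interior_Icc] at ht
    rw [(hderiv t (Ioo_subset_Icc_self ht)).deriv]
    exact (LaguerreSep.re_deriv_logDeriv_neg hf hρ0 hρ hgr hreal hex hzeros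
      (hne t (Ioo_subset_Icc_self ht))).1
  have h := hanti (left_mem_Icc.2 hcc'.le) (right_mem_Icc.2 hcc'.le) hcc'
  simp [hφ, hc, hc'] at h

/-- **Under RH the new critical zeros of `ξ^{(m+1)}` up to height `T` number at most `#crit(ξ^{(m)}, T) + 1`**:
order the critical zero ordinates `0 < t₁ < ⋯ < t_k ≤ T` of `ξ^{(m)}`; the map sending a new zero ordinate
`c` to `#{j : t_j < c} ∈ {0, …, k}` is injective (two new zeros with the same index would bound a zero-free
interval of `Ξ^{(m)}` with `Ξ^{(m+1)}` vanishing at both ends, against Laguerre's theorem; under RH all zeros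
of `Ξ^{(m)}` are real). [cite: Boas1954, Theorem 2.8.1 (p. 23)] [cite: Conrey1983, §1 (p. 49)] -/
theorem card_new_le_card_add_one (hRH : RiemannHypothesis) (m : ℕ) (T : ℝ) :
    ((criticalBox_finite (m + 1) T).toFinset.filter fun s ↦ iteratedDeriv m riemannXi s ≠ 0).card ≤
      (criticalBox_finite m T).toFinset.card + 1 := by
  classical
  -- the real entire function `Ξ^{(m)}`
  obtain ⟨ρ, C, hρ0, hρ, hgr⟩ := exists_growth_riemannXiUpper
  obtain ⟨ρ', C', hρ'0, hρ', hgr'⟩ :=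
    exists_growth_iteratedDeriv XiDerivStrip.differentiable_xiUpper hρ0 hρ hgr m
  have hfd : Differentiable ℂ (iteratedDeriv m riemannXiUpper) :=
    differentiable_iteratedDeriv_of_entire XiDerivStrip.differentiable_xiUpper m
  have hreal : ∀ x : ℝ, (iteratedDeriv m riemannXiUpper x).im = 0 :=
    im_iteratedDeriv_ofReal XiDerivStrip.differentiable_xiUpper im_riemannXiUpper_ofReal_holds m
  have hzr : ∀ a, iteratedDeriv m riemannXiUpper a = 0 → a.im = 0 := fun a ha ↦
    riemannHypothesis_imp_iteratedDeriv_riemannXiUpper_zeros_real hRH m ha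
  have hex := exists_iteratedDeriv_riemannXiUpper_eq_zero m
  have hzero_iff : ∀ (n : ℕ) (t : ℝ), iteratedDeriv n riemannXiUpper t = 0 ↔
      iteratedDeriv n riemannXi (1 / 2 + t * I) = 0 := fun n t ↦ by
    rw [iteratedDeriv_riemannXiUpper, mul_comm I (t : ℂ), mul_eq_zero,
      or_iff_right (pow_ne_zero _ I_ne_zero)]
  -- the ordinates
  set CB := (criticalBox_finite m T).toFinset with hCB
  set NF := ((criticalBox_finite (m + 1) T).toFinset.filter fun s ↦ iteratedDeriv m riemannXi s ≠ 0)
    with hNF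
  set tF : Finset ℝ := CB.image Complex.im with htF
  set nF : Finset ℝ := NF.image Complex.im with hnF
  have hinj1 : Set.InjOn Complex.im (CB : Set ℂ) := by
    intro a ha b hb h
    rw [Finset.mem_coe, hCB, Set.Finite.mem_toFinset] at ha hb
    exact Complex.ext (by rw [ha.2, hb.2]) h
  have hinj2 : Set.InjOn Complex.im (NF : Set ℂ) := by
    intro a ha b hb h
    rw [Finset.mem_coe, hNF, Finset.mem_filter, Set.Finite.mem_toFinset] at ha hb
    exact Complex.ext (by rw [ha.1.2, hb.1.2]) h
  have hcardt : tF.card = CB.card := Finset.card_image_of_injOn hinj1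
  have hcardn : nF.card = NF.card := Finset.card_image_of_injOn hinj2
  rw [← hcardt, ← hcardn]
  -- membership
  have htF : ∀ u : ℝ, u ∈ tF ↔ iteratedDeriv m riemannXi (1 / 2 + u * I) = 0 ∧ 0 < u ∧ u ≤ T := by
    intro u
    rw [htF, Finset.mem_image]
    constructor
    · rintro ⟨s, hs, rfl⟩
      rw [hCB, Set.Finite.mem_toFinset] at hs
      have hseq : (1 / 2 : ℂ) + (s.im : ℂ) * I = s := by apply Complex.ext <;> simp [hs.2]
      rw [hseq]
      exact ⟨hs.1.1, hs.1.2.1, hs.1.2.2⟩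
    · rintro ⟨h0, h1, h2⟩
      refine ⟨1 / 2 + u * I, ?_, by simp⟩
      rw [hCB, Set.Finite.mem_toFinset]
      exact ⟨⟨h0, by simpa using h1, by simpa using h2⟩, by simp⟩
  have hnF : ∀ u : ℝ, u ∈ nF → iteratedDeriv (m + 1) riemannXi (1 / 2 + u * I) = 0 ∧
      iteratedDeriv m riemannXi (1 / 2 + u * I) ≠ 0 ∧ 0 < u ∧ u ≤ T := by
    intro u hu
    rw [hnF, Finset.mem_image] at hu
    obtain ⟨s, hs, rfl⟩ := hu
    rw [hNF, Finset.mem_filter, Set.Finite.mem_toFinset] at hs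
    have hseq : (1 / 2 : ℂ) + (s.im : ℂ) * I = s := by apply Complex.ext <;> simp [hs.1.2]
    rw [hseq]
    exact ⟨hs.1.1.1, hs.2, hs.1.1.2.1, hs.1.1.2.2⟩
  -- the index map
  set ι : ℝ → ℕ := fun c ↦ (tF.filter fun x ↦ x < c).card with hι
  have hιrange : ∀ c ∈ nF, ι c ∈ Finset.range (tF.card + 1) := by
    intro c _
    rw [Finset.mem_range, Nat.lt_succ_iff]
    exact Finset.card_filter_le _ _
  have hιinj : Set.InjOn ι (nF : Set ℝ) := by
    -- the one-sided statement
    have key : ∀ c ∈ nF, ∀ c' ∈ nF, c < c' → ι c = ι c' → False := by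
      intro c hc c' hc' hlt heq
      obtain ⟨hc1, hc2, hc3, hc4⟩ := hnF c hc
      obtain ⟨hc'1, hc'2, hc'3, hc'4⟩ := hnF c' hc'
      -- no ordinate of `tF` in `[c, c')`
      have hgap : ∀ x ∈ tF, ¬(c ≤ x ∧ x < c') := by
        rintro x hx ⟨h1, h2⟩
        have hsub : (tF.filter fun y ↦ y < c) ⊆ (tF.filter fun y ↦ y < c') := by
          intro y hy
          rw [Finset.mem_filter] at hy ⊢
          exact ⟨hy.1, hy.2.trans hlt⟩
        have hxB : x ∈ tF.filter fun y ↦ y < c' := Finset.mem_filter.2 ⟨hx, h2⟩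
        have hxA : x ∉ tF.filter fun y ↦ y < c := fun h ↦ by
          rw [Finset.mem_filter] at h; linarith [h.2]
        have hlt' : ι c < ι c' := Finset.card_lt_card ⟨hsub, fun h ↦ hxA (h hxB)⟩
        omega
      -- hence `Ξ^{(m)}` has no zero on `[c, c']`
      have hfree : ∀ x ∈ Icc c c', iteratedDeriv m riemannXiUpper x ≠ 0 := by
        intro x hx h0
        have h0' := (hzero_iff m x).1 h0
        have hxT : x ∈ tF := (htF x).2 ⟨h0', by linarith [hx.1], hx.2.trans hc'4⟩
        rcases eq_or_lt_of_le hx.2 with hxc' | hxc'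
        · rw [hxc'] at h0'; exact hc'2 h0'
        · exact hgap x hxT ⟨hx.1, hxc'⟩
      have hd : ∀ u : ℝ, deriv (iteratedDeriv m riemannXiUpper) u = 0 ↔
          iteratedDeriv (m + 1) riemannXi (1 / 2 + u * I) = 0 := fun u ↦ by
        rw [← iteratedDeriv_succ]; exact hzero_iff (m + 1) u
      exact deriv_ne_zero_of_zero_free hfd hρ'0 hρ' hgr' hreal hex hzr hlt hfree ((hd c).2 hc1)
        ((hd c').2 hc'1)
    intro c hc c' hc' heq
    rcases lt_trichotomy c c' with h | h | h
    · exact (key c hc c' hc' h heq).elim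
    · exact h
    · exact (key c' hc' c hc h heq.symm).elim
  have := Finset.card_le_card_of_injOn ι hιrange hιinj
  rwa [Finset.card_range] at this

/-- Under RH the new critical zeros of `ξ^{(m+1)}` are simple, so their total multiplicity is their number.
[cite: Boas1954, Theorem 2.8.1 (p. 23)] [cite: Conrey1983, §1 (p. 49)] -/
theorem sum_new_eq_card (hRH : RiemannHypothesis) (m : ℕ) (T : ℝ) :
    ∑ s ∈ ((criticalBox_finite (m + 1) T).toFinset.filter fun s ↦ ¬iteratedDeriv m riemannXi s = 0),
        (analyticOrderAt (iteratedDeriv (m + 1) riemannXi) s).toNat =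
      ((criticalBox_finite (m + 1) T).toFinset.filter fun s ↦ iteratedDeriv m riemannXi s ≠ 0).card := by
  classical
  rw [Finset.card_eq_sum_ones]
  refine Finset.sum_congr rfl fun s hs ↦ ?_
  rw [Finset.mem_filter, Set.Finite.mem_toFinset] at hs
  have h0 : iteratedDeriv (m + 1) riemannXi s = 0 := hs.1.1.1
  have h2 : iteratedDeriv (m + 2) riemannXi s ≠ 0 :=
    riemannHypothesis_imp_iteratedDeriv_succ_zero_simple hRH m h0 hs.2
  have ha : AnalyticAt ℂ (iteratedDeriv (m + 1) riemannXi) s :=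
    analyticOnNhd_iteratedDeriv_riemannXi (m + 1) s trivial
  have h1 := ha.analyticOrderAt_sub_eq_one_of_deriv_ne_zero (by
    rw [← iteratedDeriv_succ]; exact h2)
  have hfun : (fun z ↦ iteratedDeriv (m + 1) riemannXi z - iteratedDeriv (m + 1) riemannXi s) =
      iteratedDeriv (m + 1) riemannXi := by
    funext z; rw [h0, sub_zero]
  rw [hfun] at h1
  rw [h1]
  rfl

end XiDerivCritStep

/-- **RH ⇒ `N^{(m+1)}(T) ≤ N^{(m)}(T) + 1` for all `T`**: under RH the new zeros of `ξ^{(m+1)}` are simple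
and separated by the zeros of `ξ^{(m)}` (Laguerre), so differentiating gains at most one zero up to
height `T`. [cite: Boas1954, Theorem 2.8.1 (p. 23)] [cite: Conrey1983, §1 (p. 49) and Lemma 2 (p. 52)] -/
theorem riemannHypothesis_imp_xiDerivZeroCount_succ_le_add_one (hRH : RiemannHypothesis) (m : ℕ)
    (T : ℝ) : xiDerivZeroCount (m + 1) T ≤ xiDerivZeroCount m T + 1 := by
  classical
  rw [← xiDerivCriticalZeroCount_eq_of_RH hRH m T, ← xiDerivCriticalZeroCount_eq_of_RH hRH (m + 1) T]
  have h1 := sum_old_add_card m T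
  have h2 := sum_old_eq m T
  have h3 := card_new_le_card_add_one hRH m T
  have h4 := sum_new_eq_card hRH m T
  have h5 : xiDerivCriticalZeroCount (m + 1) T =
      ∑ s ∈ ((criticalBox_finite (m + 1) T).toFinset.filter fun s ↦ iteratedDeriv m riemannXi s = 0),
          (analyticOrderAt (iteratedDeriv (m + 1) riemannXi) s).toNat +
        ∑ s ∈ ((criticalBox_finite (m + 1) T).toFinset.filter fun s ↦ ¬iteratedDeriv m riemannXi s = 0),
          (analyticOrderAt (iteratedDeriv (m + 1) riemannXi) s).toNat := by
    unfold xiDerivCriticalZeroCount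
    rw [finsum_mem_eq_finite_toFinset_sum _ (criticalBox_finite (m + 1) T)]
    exact (Finset.sum_filter_add_sum_filter_not _ _ _).symm
  omega

/-- **RH ⇒ `|N^{(m+1)}(T) − N^{(m)}(T)| ≤ 1` for every `m` and every `T`** — the exact form, under RH,
of Conrey's Lemma 2 `N^{(m)}(T) = N(T) + O_m(log T)`.
[cite: Boas1954, Theorem 2.8.1 (p. 23)] [cite: Conrey1983, Lemma 2 (p. 52)] -/
theorem riemannHypothesis_imp_abs_xiDerivZeroCount_succ_sub_le_one (hRH : RiemannHypothesis) (m : ℕ)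
    (T : ℝ) : |(xiDerivZeroCount (m + 1) T : ℤ) - xiDerivZeroCount m T| ≤ 1 := by
  have h1 := riemannHypothesis_imp_xiDerivZeroCount_succ_le_add_one hRH m T
  have h2 := riemannHypothesis_imp_xiDerivZeroCount_le_succ_add_one hRH m T
  rw [abs_le]
  constructor <;> omega

/-- **RH ⇒ `|N^{(m)}(T) − N^{(0)}(T)| ≤ m` for every `m` and every `T`** (`N^{(0)}(T) = xiDerivZeroCount 0 T`,
the zeros of `ξ` with `0 < Im s ≤ T` counted with multiplicity).
[cite: Boas1954, Theorem 2.8.1 (p. 23)] [cite: Conrey1983, Lemma 2 (p. 52)] -/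
theorem riemannHypothesis_imp_abs_xiDerivZeroCount_sub_zero_le (hRH : RiemannHypothesis) (m : ℕ)
    (T : ℝ) : |(xiDerivZeroCount m T : ℤ) - xiDerivZeroCount 0 T| ≤ m := by
  induction m with
  | zero => simp
  | succ m ih =>
    have h := riemannHypothesis_imp_abs_xiDerivZeroCount_succ_sub_le_one hRH m T
    rw [abs_le] at h ih ⊢
    push_cast
    constructor <;> omega

/-! ## `N^{(0)}(T) = N(T)`, and the RH statements relative to `N(T)` -/

namespace XiDerivCritStep

/-- In the critical strip the multiplicity of `ρ` as a zero of `ξ = ξ^{(0)}` (`analyticOrderAt`, in `ℕ`,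
cast to `ℤ`) is `m(ρ) = riemannZetaZeroOrder ρ` (`ξ = ½s(s−1)Γℝ(s)·ζ(s)` with a non-vanishing analytic
cofactor). [cite: Titchmarsh1986, §2.12] -/
theorem natCast_order_zero_eq_riemannZetaZeroOrder {ρ : ℂ} (h0 : 0 < ρ.re) (h1 : ρ.re < 1) :
    (((analyticOrderAt (iteratedDeriv 0 riemannXi) ρ).toNat : ℕ) : ℤ) = riemannZetaZeroOrder ρ := by
  rw [iteratedDeriv_zero]
  have hρ0 : ρ ≠ 0 := fun h ↦ by simp [h] at h0
  have hρ1 : ρ ≠ 1 := fun h ↦ by simp [h] at h1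
  set u : ℂ → ℂ := fun s ↦ 2 / (s * (s - 1)) * (Gammaℝ s)⁻¹ with hu
  have hu_an : AnalyticAt ℂ u ρ := by
    have h2 : AnalyticAt ℂ (fun s : ℂ ↦ 2 / (s * (s - 1))) ρ := by
      apply AnalyticAt.div analyticAt_const (by fun_prop)
      exact mul_ne_zero hρ0 (sub_ne_zero.mpr hρ1)
    exact h2.mul (differentiable_Gammaℝ_inv.analyticAt ρ)
  have hu_ne : u ρ ≠ 0 := by
    simp only [u]
    refine mul_ne_zero (div_ne_zero two_ne_zero (mul_ne_zero hρ0 (sub_ne_zero.mpr hρ1))) ?_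
    exact inv_ne_zero (Gammaℝ_ne_zero_of_re_pos h0)
  have hU : ∀ᶠ s in 𝓝 ρ, s ≠ 0 ∧ s ≠ 1 := (isOpen_ne.inter isOpen_ne).mem_nhds ⟨hρ0, hρ1⟩
  have heq : (riemannXi * u) =ᶠ[𝓝 ρ] riemannZeta := by
    filter_upwards [hU] with s hs
    have hss : s * (s - 1) ≠ 0 := mul_ne_zero hs.1 (sub_ne_zero.mpr hs.2)
    have hc : s * (s - 1) / 2 * (2 / (s * (s - 1))) = 1 := by
      rw [div_mul_div_comm, mul_comm (s * (s - 1)) 2, div_self (mul_ne_zero two_ne_zero hss)]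
    calc (riemannXi * u) s
        = (s * (s - 1) / 2 * (2 / (s * (s - 1)))) * (completedRiemannZeta s * (Gammaℝ s)⁻¹) := by
          rw [Pi.mul_apply, riemannXi_eq_mul_completedRiemannZeta hs.1 hs.2]; simp only [u]; ring
      _ = riemannZeta s := by rw [hc, one_mul, riemannZeta_def_of_ne_zero hs.1, div_eq_mul_inv]
  have hord : analyticOrderAt riemannZeta ρ = analyticOrderAt riemannXi ρ := by
    rw [← analyticOrderAt_congr heq,
      analyticOrderAt_mul ((differentiable_riemannXi).analyticAt ρ) hu_an,
      (hu_an.analyticOrderAt_eq_zero).mpr hu_ne, add_zero]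
  have hζa : AnalyticAt ℂ riemannZeta ρ := analyticOn_riemannZeta ρ hρ1
  have hnt : analyticOrderAt riemannXi ρ ≠ ⊤ := by
    have := analyticOrderAt_ne_top 0 ρ
    rwa [iteratedDeriv_zero] at this
  obtain ⟨n, hn⟩ := ENat.ne_top_iff_exists.mp hnt
  rw [riemannZetaZeroOrder, hζa.meromorphicOrderAt_eq, hord, ← hn]
  simp

/-- The box of zeros of `ξ^{(0)} = ξ` with `0 < Im s ≤ T` is the box of non-trivial zeros of `ζ` with
`0 < Im ρ ≤ T`. [cite: Titchmarsh1986, §2.12] -/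
theorem xiDerivZeroBox_zero_eq (T : ℝ) : xiDerivZeroBox 0 T = zetaZeroBox 0 T := by
  ext ρ
  simp only [xiDerivZeroBox, zetaZeroBox, mem_setOf_eq, iteratedDeriv_zero]
  constructor
  · rintro ⟨hξ, h1, h2⟩
    obtain ⟨hζ, hr0, hr1⟩ := (riemannXi_eq_zero_iff_holds ρ).1 hξ
    exact ⟨hζ, hr0.le, hr1.le, h1, h2⟩
  · rintro ⟨hζ, -, -, h1, h2⟩
    have hst := re_mem_Ioo_of_riemannZeta_eq_zero_of_im_ne_zero hζ h1.ne'
    exact ⟨(riemannXi_eq_zero_iff_holds ρ).2 ⟨hζ, hst.1, hst.2⟩, h1, h2⟩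

end XiDerivCritStep

/-- **`N^{(0)}(T) = N(T)`**: the zeros of `ξ` with `0 < Im s ≤ T`, counted with their multiplicities as
zeros of `ξ`, are the non-trivial zeros of `ζ` up to height `T` counted with multiplicity.
[cite: Titchmarsh1986, §2.12] [cite: Conrey1983, §1 (p. 49)] -/
theorem xiDerivZeroCount_zero_eq_zetaZeroCount (T : ℝ) : xiDerivZeroCount 0 T = zetaZeroCount T := by
  classical
  apply Nat.cast_injective (R := ℤ)
  rw [zetaZeroCount_eq_finsum, xiDerivZeroCount, ← XiDerivCritStep.xiDerivZeroBox_zero_eq]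
  have hfin := xiDerivZeroBox_finite 0 T
  rw [show ((∑ᶠ s ∈ xiDerivZeroBox 0 T, (analyticOrderAt (iteratedDeriv 0 riemannXi) s).toNat : ℕ) : ℤ) =
      ∑ᶠ s ∈ xiDerivZeroBox 0 T, (((analyticOrderAt (iteratedDeriv 0 riemannXi) s).toNat : ℕ) : ℤ) from
    AddMonoidHom.map_finsum_mem (fun s ↦ (analyticOrderAt (iteratedDeriv 0 riemannXi) s).toNat)
      (Nat.castAddMonoidHom ℤ) hfin]
  refine finsum_mem_congr rfl fun ρ hρ ↦ ?_
  have h := hρ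
  rw [XiDerivCritStep.xiDerivZeroBox_zero_eq] at h
  have hst := re_mem_Ioo_of_riemannZeta_eq_zero_of_im_ne_zero h.1 h.2.2.2.1.ne'
  exact XiDerivCritStep.natCast_order_zero_eq_riemannZetaZeroOrder hst.1 hst.2

/-- **RH ⇒ `|N^{(m)}(T) − N(T)| ≤ m` for every `m` and EVERY `T > 0`** — under RH, Conrey's
`N^{(m)}(T) = N(T) + O_m(log T)` holds with the error bounded by `m` in absolute value.
[cite: Boas1954, Theorem 2.8.1 (p. 23)] [cite: Conrey1983, Lemma 2 (p. 52)] -/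
theorem riemannHypothesis_imp_abs_xiDerivZeroCount_sub_zetaZeroCount_le (hRH : RiemannHypothesis)
    (m : ℕ) (T : ℝ) : |(xiDerivZeroCount m T : ℤ) - zetaZeroCount T| ≤ m := by
  rw [← xiDerivZeroCount_zero_eq_zetaZeroCount]
  exact riemannHypothesis_imp_abs_xiDerivZeroCount_sub_zero_le hRH m T

/-- Unconditionally, WITH multiplicity: **`N₀(T)`-type lower bound `N(T) ≤ N₀^{(m)}(T) + m` under RH** is the
special case; without RH we still have **`N₀^{(0)}(T) ≤ N₀^{(m)}(T) + m`** (`xiDerivCriticalZeroCount_zero_le_add`)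
where `N₀^{(0)}(T)` counts the critical zeros of `ζ` with multiplicity — so every critical-line proportion
of `ζ` counted WITH multiplicity transfers to `ξ^{(m)}`: if eventually `c · N(T) ≤ N₀^{(0)}(T) + K` then
eventually `c · N(T) ≤ N₀^{(m)}(T) + K + m`. [cite: Conrey1983, §1 (p. 49)] -/
theorem xiDerivCriticalZeroCount_transfer (m : ℕ) {c K : ℝ}
    (h : ∀ᶠ T : ℝ in atTop, c * (zetaZeroCount T : ℝ) ≤ xiDerivCriticalZeroCount 0 T + K) :
    ∀ᶠ T : ℝ in atTop, c * (zetaZeroCount T : ℝ) ≤ xiDerivCriticalZeroCount m T + (K + m) := by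
  filter_upwards [h] with T hT
  have h1 : (xiDerivCriticalZeroCount 0 T : ℝ) ≤ xiDerivCriticalZeroCount m T + m := by
    exact_mod_cast xiDerivCriticalZeroCount_zero_le_add m T
  linarith

end Literature.NumberTheory.LFunctions

end
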